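import Mathlib
import HarnessLib
import HarnessLib.Audit
import Summits.CriticalPhenomena.Statement
import Literature.Probability.Percolation.CardyFormula
import HarnessLib.Audit.Status.Attr

/-!
Route: CardyPolygonWords

DORMANT since 2026-08-24T00:11:30Z (reconciler: no traction for 6.4 d (last activity item-evidence-added at 2026-08-17T14:51:06Z); parked, not closed — `ledger route dormant route-CriticalPhenomena-CardyPolygonWords --off` to reactivate) — unstaffed, not closed; items shared with open routes are served there. `ledger route dormant <id> --off` reactivates.

# Route CardyPolygonWords — polygons are Temperley–Lieb words — Cardy on lattice polygons from
rectangle data plus one junction vertex, then Carathéodory density to every Jordan domain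

It suffices to show X = CardyLatticePolygon: Cardy's formula (bond-ℤ², p = 1/2, G02 discretisation
`bondDomainCrossingProb`,
limit `cardyFunction` of the cross-ratio) for every conformal rectangle whose carrier is the
interior of a finite union of closed
squares of one lattice δ₀ℤ² (a polyomino Jordan domain) and whose four marks are δ₀-lattice points.
Realises card
corners-are-morphisms: (1) X → conjunct is a soft reduction (marked lattice polygons are
Carathéodory-dense among marked Jordan
domains; Radó gives η-continuity; Russo–Seymour–Welsh gives Schramm–Smirnov equicontinuity of δ ↦
P_δ(Q) in the quad, so limits
commute) — this is the Assembly; (2) at aligned meshes P_δ of a lattice polygon is EXACTLY a word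
⟨β| T … J … T |α⟩ in the stochastic
Temperley–Lieb(β=1) row-transfer matrices T_n of varying width and canonical
free-site-insertion/restriction maps J (junctions), so X is a
statement about scaling limits of words: rectangle data (towers x ∈ {0,1/3,1,4/3,2,…} and boundary
overlaps — crux CardyRectangle, the
unproved input shared with card tl-spectral-kleban-zagier) plus ONE new datum, the scaling limit of
junction overlaps, predicted to be
the Schwarz–Christoffel vertex of the local step geometry (crux CardyOneStep at probability level;
operator-level items filed informally
until the transfer-matrix definitions land).
Lean: `∀ R : Literature.Probability.RandomPlanarGeometry.ConformalRectangle, (∃ δ₀ : ℝ, 0 < δ₀ ∧ (∃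
s : Finset (ℤ × ℤ), R.carrier = interior (⋃ p ∈ s, {z : ℂ | δ₀ * (p.1 : ℝ) ≤ z.re ∧ z.re ≤ δ₀ *
((p.1 : ℝ) + 1) ∧ δ₀ * (p.2 : ℝ) ≤ z.im ∧ z.im ≤ δ₀ * ((p.2 : ℝ) + 1)})) ∧ ∀ i, ∃ m n : ℤ, R.pt i =
(δ₀ : ℂ) * ((m : ℂ) + (n : ℂ) * Complex.I)) → R.HasCrossingLimit
(Literature.Probability.Percolation.bondDomainCrossingProb R)
Literature.Probability.RandomPlanarGeometry.cardyFunction`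

## Assembly
The Assembly IS the card's PolygonReduction (P1): CardyLatticePolygon → CardyFormulaZ2. Proof plan
(standard reductions, no new idea):
(i) scaling: P_δ(λΩ; λ-marks) = P_{δ/λ}(Ω; marks) exactly for the G02 discretisation
(meshVertices/meshGraph/discreteArc are defined through
δ·x ∈ Ω and infDist comparisons), so WLOG δ₀ = 2^{-k}; (ii) density: for a marked Jordan domain (Ω;
a,b,c,d) the inner dyadic polyomino
approximations Π_k (component of the union of closed 2^{-k}-squares inside Ω containing a fixed
point, marks moved to nearest boundary lattice
points) converge to Ω as a Carathéodory kernel with uniformly locally connected complements, so the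
normalised Riemann maps converge uniformly
on the closed disc (Radó; Pommerenke1992 Thm 2.11, Cor. 2.4) and the cross-ratio η(Π_k) → η(Ω);
(iii) equicontinuity: from `rsw_half_holds`
alone, for every marked Jordan quad Q and ε > 0 there are a neighbourhood U (in the Schramm–Smirnov
quad metric) and δ₁ > 0 with
|P_δ(Q') − P_δ(Q)| < ε for Q' ∈ U, δ < δ₁ (SchrammSmirnov2011 Lemma 6.1 = arXiv:1101.5820 §6
'Continuity of crossing events', whose proof is 'a simple application of the RSW
estimate and the lowest crossing concept', plus Lemma 5.1 (crossing events have null boundary); GPS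
arXiv:1008.1378 §2.2; the G02 largest-component/closest-arc conventions are the ones already tamed
in
`discreteCrossingProb_clusterPt_mem_Ioo_holds`); (iv) continuity of `cardyFunction` on (0,1)
(`cardyFunction` facts in
Literature.Probability.RandomPlanarGeometry.CardyFunction) and a 3ε argument. Difficulty L (long,
RSW-only); it is also the support lemma
wanted by cards discretisation-bridge-by-polygons (D2) and osgood-boundary-bulk-wins, so one proof
serves three cards.

Rationale: WHY THIS LINE. Every integrable/spectral card of this sub-problem (tl-spectral-kleban-zagier,
jordan-free-crossing-module, size-changing-susy-intertwiners,
combinatorial-point-anchor, cylinder-exp-covariance) stops at rectangles, strips or cylinders and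
then borrows an analytic upgrade crux
(ConfInvTransport, X_U of CardyUniqueLimit, SLE₆) to reach arbitrary Jordan domains; this line
observes that the transfer-matrix method
continues to ALL axis-parallel lattice polygons — a polygon is a word in one small category
generated by {T_n, J} (folklore; Read–Saleur
lattice fusion, BJS arXiv:1207.7005 rectangle amplitudes) — and that lattice polygons already
exhaust the conjunct by Carathéodory
density + Schramm–Smirnov/GPS quad-equicontinuity (SchrammSmirnov2011 Lemma 6.1, arXiv:1008.1378 §2,
Pommerenke1992 Ch. 2), so no conformal-
invariance upgrade is needed beyond ONE local datum: the junction overlap ⟨ψ'|J|ψ⟩ between scaling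
states of strips of different widths,
the loop-model analogue of the Dubail–Stéphan bipartite fidelity
(doi:10.1088/1742-5468/2011/03/l03002; exact lattice vs log-CFT at
c = −2 in arXiv:1902.02246), whose continuum value is fixed by the Schwarz–Christoffel map of the
step-in-a-channel. Imported areas:
Temperley–Lieb/Bethe-ansatz integrability at the Razumov–Stroganov point Δ = −1/2 (qKZ inter-size
recursions, dynamic lattice SUSY
arXiv:1612.02951 as tools for the junction), boundary CFT sewing at c = 0, classical conformal
mapping (Schwarz–Christoffel, Radó),
RSW percolation technology for the reduction. What it does that prior routes do not:
CardyUniqueLimit/CardyRotToConf need X_U or a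
similarity-to-conformal upgrade for all domains; CardyIsoradial/HarmonicInvariants/DiscreteHolo need
an observable or a triangular
anchor; here the only global step is a density argument resting on proved RSW (`rsw_half_holds`,
`discreteCrossingProb_clusterPt_mem_Ioo_holds`).
Negatives index (1 item, SAW sub-problem) is not touched.

RANKED CRUXES. #0 CardyLatticePolygon (target) — Cardy's formula in the G02 discretisation for every
conformal rectangle whose carrier is the interior of a finite union of closed δ₀-lattice squares (a
polyomino Jordan domain) and whose four marks are δ₀-lattice points, for some δ₀ > 0 (card:
CardyPolygon). (why it might fail: Equivalent to the conjunct given the Assembly, so false only if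
Cardy fails on ℤ²; as a TARGET of the word mechanism it fails if junction overlaps do not converge
summably (c=0 Jordan cells at junctions) or converge to non-conformal values.) [Cardy1992,
Smirnov2001, SchrammSmirnov2011, arXiv:1207.7005, arXiv:1608.00170]
#2 CardyRectangle (crux) — Cardy's formula (G02 discretisation, bond-ℤ², p = 1/2) for every
rectangle (0,a)×(0,b) with the four CORNERS marked — the words of length one ⟨β|T_n^m|α⟩; the
unproved input of the whole transfer-matrix programme (conclusion of card tl-spectral-kleban-zagier:
TL(β=1)/XXZ(Δ=−1/2) conformal towers + boundary-state overlaps, even conformal block, Kleban–Zagier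
rigidity + exact ℤ² duality Π(r)+Π(1/r)=1). Ranked first because everything downstream is
conditional on it; this route adds nothing to its proof and shares the item with any route opened
for that card. [difficulty: open-problem] (why it might fail: It IS conformal invariance for one
shape family, open since Cardy1992 / Schramm2007ICM Prob. 2.11; the only engine (Bethe-ansatz
control of TL(β=1) towers AND amplitudes, uniform in the level) is open even at physics rigour; a
Jordan-cell term r·e^{-πr/3} (c=0 log CFT) would break it.) [Cardy1992, Schramm2007ICM,
arXiv:math-ph/0209023, arXiv:math-ph/0103018, arXiv:1207.7005, arXiv:1110.6861, arXiv:1701.08167,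
arXiv:1202.5476, arXiv:1101.2885, Beffara2008Universal]
#3 CardyOneStep (crux) — Cardy's formula (G02 discretisation) for every ONE-STEP polygon — two
stacked open rectangles (0,a)×(0,b) and (c,d)×(b,b+e) sharing the open stretch (max 0 c, min a
d)×{b} of horizontal side — with the two bottom and the two top corners marked: the words
⟨β|T_{n'}^{m'} J T_n^{m}|α⟩ with exactly one junction letter (L-, T- and Z-steps, all arm lengths).
This is the probability-level form of the card's cruxes P2+P3: given CardyRectangle, it says that
the scaling limits of the junction overlaps between the boundary-state-visible scaling states exist
and equal the Schwarz–Christoffel step vertex (card corners-are-morphisms, P2 JunctionOverlapLimit /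
P3 StepMapVertex). [deps: CardyRectangle] [difficulty: XL] (why it might fail: First word with a
junction letter: the lattice junction may keep an anomalous O(1) excess length ≠ the conformal one,
or log terms (c=0 Jordan partners enter at geometry changes, cf. 2π-corner logs arXiv:1303.3633);
decided by exact TM arithmetic at widths ≤ 12 vs a Schwarz–Christoffel modulus.)
[doi:10.1088/1742-5468/2011/03/l03002, arXiv:1902.02246, arXiv:1303.3633, arXiv:1608.00170,
arXiv:1407.8163, arXiv:1612.02951, arXiv:2408.15659, SchrammSmirnov2011]

TWO-LAYER PLAN. Foreseen glued splits, filed only when something closes or the definitions land: (a)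
CardyLatticePolygon ⇐ RowTransferExactness →
JunctionOverlapLimit → WordSewing → CardyLatticePolygon, where RowTransferExactness (support,
provable once `PercolationRowTransfer` exists:
P_δ(Π) = ⟨β|word|α⟩ exactly, finite Markov-chain bookkeeping on row-connectivity states),
JunctionOverlapLimit (crux, filed informally at
open: normalised overlaps ⟨ψ_l^{(n')}, J ψ_k^{(n)}⟩ of low-lying scaling eigenvectors converge with
ℓ¹ tails, for every free-site-insertion
type incl. the pants/merge junction of non-row-convex polygons) and WordSewing (glue: rectangle data
+ junction limits + Schwarz–Christoffel
composition = cardyFunction(η(Π))); (b) CardyOneStep ⇐ LeadingJunction (h = 1/3 sector only: long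
arms, the junction 'excess length' equals
the conformal excess modulus of the step) → FullTowerOneStep → CardyOneStep; (c) Assembly ⇐
QuadEquicontinuityZ2 → PolygonDensity → Assembly
if provers want the RSW part and the complex-analysis part separated.

KILL CRITERIA. Close `refuted:CardyOneStep` (and flag the conjunct to the operator) if exact
transfer-matrix arithmetic, extrapolated in the width, puts the
one-step crossing limit measurably off cardyFunction(η) for an L-step — the junction thesis is dead.
Pivot (not close) if JunctionOverlapLimit
fails only through M·λ^M / logarithmic terms: re-file the sewing through the staggered (Jordan)
module, consuming card jordan-free-crossing-module.
CardyRectangle refuted ⇒ the conjunct is false as typed (report; every Cardy route closes). If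
CardyUniqueLimit's X_U + CardyRigidity land
first, cruxes 2–3 are mooted as corollaries and the route is superseded, but the Assembly (polygon
reduction) stays a useful support lemma.
A counterexample to quad-equicontinuity for the G02 largest-component rule on a fat Jordan boundary
kills the Assembly AS TYPED only (then
re-type X over osgood-boundary-bulk-wins' hygienic discretisation).

NOT DECOMPOSED YET. The operator-level cruxes (JunctionOverlapLimit, StepMapVertex) and the support
items RowTransferExactness / GroundStateJunctions (exact
Δ = −1/2 closed forms for the leading junction overlaps via qKZ/ASM recursions) are filed INFORMALLY
right after open and typed once the
definition request `PercolationRowTransfer` (row-connectivity state spaces, stochastic TL(β=1)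
transfer matrices T_n, boundary vectors α, β,
free-site insertion/restriction maps J) lands; the pants/merge junction needed for non-row-convex
polygons; the split of the Assembly into
RSW-equicontinuity and Radó parts; spectral-gap uniformity (gap·n bounded below) and the ℓ¹ tail
bounds; the Schwarz–Christoffel
bookkeeping identifying composed vertices with cardyFunction(η(Π)). None of these is a third layer:
they are children of the Target or of
CardyOneStep (k ≤ 3 each).

CHEAPEST FALSIFIER. Exact rational transfer-matrix computation (kit, widths n ≤ 10–12, link-pattern
basis with the bottom-arc marking) of the bottom-to-top
crossing probability of the left-aligned L-step n → 2n (ρ = 2) and 2n → n with long arms m = 3n, m'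
= 3n', extrapolated in n (corrections
~ n^{-1}, n^{-2}), against cardyFunction(η) with η of the continuum L-step from a numerical
Schwarz–Christoffel map (1e-8); equivalently
compare the lattice junction 'excess length' with the classical conformal excess modulus of an
abrupt width change in a channel. A 1e-3
level disagreement stable under extrapolation kills CardyOneStep and the line. Not run here (planner
seat, no kit in plancard mode);
published Monte-Carlo/TM checks of Cardy-type formulas in hexagons agree to ~1e-3 on the triangular
lattice (arXiv:1407.8163) — no ℤ²
polygon transfer-matrix study was found.

NUMBERS. Boundary conformal tower of percolation words: h ∈ {h_{1,1} = 0, h_{1,3} = 1/3, h_{1,5} =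
2, …} + integers; long-rectangle tail
P(top↔bottom, aspect r) ≍ e^{−πr/3} (Cardy1992; Kleban–Zagier arXiv:math-ph/0209023 Thm 1: even
conformal block of dimension 1/3);
exact ℤ² boundary passage exponent 1/3 on the strip (Ikhlef–Ponsaing arXiv:1202.5476); half-plane
arm exponents used by the Assembly's
RSW part: none beyond RSW (no β₃⁺ = 2 needed if the lowest-crossing conditioning is used). Items at
open: 4 typed (target, assembly,
2 cruxes) + 4 informal (2 cruxes, 2 support) + 1 definition request.

DEFINITION REQUESTS. `PercolationRowTransfer` (topic Literature/Probability/LatticeModels; shared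
with cards tl-spectral-kleban-zagier, jordan-free-crossing-module,
size-changing-susy-intertwiners): for a finite set S ⊂ ℤ of columns, the state space V_S of
row-connectivity patterns (set partitions of
S ⊔ {bottom-arc} realisable by planar connections), the stochastic row-to-row transfer matrix T_S of
bond percolation at p = 1/2 with free
side walls (a Markov kernel on V_S), the initial vector α (bottom row wired to the bottom arc) and
read-out functional β (some top-row site
in the bottom-arc class), and for S ⊆ S' the canonical maps J_{S,S'} : V_S → V_{S'} (new sites as
singletons) and J_{S',S} (restriction);
plus the exactness lemma P_δ(lattice polygon word) = ⟨β| … |α⟩ as a support statement. Cite-fact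
wanted (for the Assembly prover, not as a
hypothesis): Schramm–Smirnov quad-equicontinuity on ℤ² (SchrammSmirnov2011 Lemma 6.1;
arXiv:1008.1378 §2.2).

Novelty: Searches (2026-08-15): `lit search --source zbmath "crossing probability rectangle percolation"`
(13: Cardy1992, KohlerSchindlerTassion2023,
Dubédat arXiv:math/0405074 Watts, FSKZ arXiv:1608.00170, SKFZ arXiv:1103.5691, Delfino–Viti
arXiv:1110.6355); `… "percolation hexagon crossing"`
(4: FZS arXiv:1407.8163 hexagon numerics, FSKZ); `… "percolation transfer matrix crossing"` (4:
Jacobsen–Zinn-Justin cond-mat/0111374, MDKP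
arXiv:2211.12379 / arXiv:1701.08167); `… "Temperley-Lieb rectangle"` (6, none relevant); `… "Dubail
Stephan fidelity critical"` (2:
arXiv:1303.3633, arXiv:1902.02246); `lit search --source crossref "bipartite fidelity"` (8:
Dubail–Stéphan 2011 doi:10.1088/1742-5468/2011/03/l03002,
Weston 2012 doi:10.1088/1742-5468/2012/04/l04001, MD–Parez–Liénardy 2021
doi:10.1088/1742-5468/abc1eb); `lit vsearch "transfer matrices of
different widths glued … junction"` (12 books, none relevant); `lit galaxy search "crossing
probability L-shaped" --star all` (0);
`lit frontier CriticalPhenomena --since 2021` (30, none on polygon crossings/TM); `lit bridges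
CriticalPhenomena --cross any`; openalex/arxiv/s2
rate-limited (HTTP 429) and local searchd reset at filing — refuter please re-run "crossing
probability polygon transfer matrix percolation" there.
Plus the card's refuter audit (SS11 Lemma 5.1 p.21, GPS13 §2, Dubédat math/0507276, FSKZ, BDJS
arXiv:1110.6861, BJS arXiv:1207.7005, Read–Saleur
fusion, Hagendorf–Liénardy arXiv:1612.02951, Borsi–Pozsgay arXiv:2408.15659).
Neares  [refs: 10.1088/1742-5468/2011/03/l03002, 10.1088/1742-5468/2012/04/l04001, 10.1088/1742-5468/abc1eb, math/0405074, 1608.00170, 1103.5691, 1110.6355, 1407.8163, 2211.12379, 1701.08167, 1303.3633, 1902.02246, 1110.6861, 1207.7005, 1612.02951, 2408.15659, 1101.5820, 1008.1378, math-ph/0103018, math/0507276, doi:10.1088/1742-5468/2011/03/l03002, doi:10.1088/1742-5468/2012/04/l04001, doi:10.1088/1742-5468/abc]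

Barriers (technique_class: transfer-matrix-words junction-overlap polygon-reduction): - technique_class: transfer-matrix-words junction-overlap polygon-reduction
- Literature.Barriers.CriticalPhenomena.EmbeddingModulusUniqueness: APPLIES in a precise way and is
evaded only through the rank-2 input: the word ⟨β|T…J…T|α⟩ of a lattice polygon is blind to every
shear φ_β of the embedding (same graph, same rows), so nothing in RowTransferExactness or in the
junction maps distinguishes ℤ² from diag(1,p)·ℤ²; the embedding-specific input enters exactly where
the barrier's evasions (i)/(ii) say it must — in CardyRectangle (isotropic integrable point: scaled
gaps n·log(λ₀/λ_k) → π·x_k with sound velocity 1, and the quarter-turn duality Π(r)+Π(1/r)=1 of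
tl-spectral-kleban-zagier) — and every later item is an implication from that non-blind hypothesis,
which the barrier does not block (its scope caveat (c)/(f)). Consistently, the junction datum itself
is axis-stretch covariant (the infinite step domain is invariant under (x,y) ↦ (x,py)), as it must
be for a blind object. The Assembly is embedding-blind and proves no invariance: it only relocates
the conjunct to polygons.
- Literature.Barriers.CriticalPhenomena.SmirnovTriangularOnly: not in class — no colour switching,
no harmonic triple, no discrete contour integral.
- Literature.Barriers.CriticalPhenomena.FKParafermionicHalfCauchyRiemann: not in class — no
parafermionic observable or discrete Riemann–Hilbert problem; the inputs are global spectral/overlap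
data of the stochastic TL chain.
- Literature.Barriers.CriticalPhe

History (route lifecycle, newest last):
- 2026-08-16T03:50:10Z · AUTO-CRUX (backfill): CardyLatticePolygon — hypotheses of the deciding theorem that nothing in the route derives are cruxes (operator:999:586464)
- 2026-08-24T00:11:30Z · DORMANT — reconciler: no traction for 6.4 d (last activity item-evidence-added at 2026-08-17T14:51:06Z); parked, not closed — `ledger route dormant route-CriticalPhenomen (operator:999:1062135)

sub-problem: CardyFormulaZ2 · status: dormant · opened planner-plancard-CriticalPhenomena-CardyFormu-5b3d1d3e-0 2026-08-15T11:35:03Z · rev 4 · ledger route-CriticalPhenomena-CardyPolygonWords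
GENERATED by the gate from the ledger (D-0016/17). Provers cite these decls: `theorem foo : Summit.CriticalPhenomena.CardyFormulaZ2.Theses.CardyPolygonWords.<Decl> := …` in Summits/CriticalPhenomena/CardyFormulaZ2/Theorems/<Name>.lean.
-/

namespace Summit.CriticalPhenomena.CardyFormulaZ2.Theses.CardyPolygonWords

open scoped BigOperators Topology Manifold Classical MeasureTheory ProbabilityTheory Matrix InnerProductSpace ComplexConjugate ContinuousMap
open Filter Set Function TopologicalSpace MeasureTheory

attribute [summit_statement] _root_.CardyFormulaZ2

/-- item stmt-CriticalPhenomena-4781 · crux (kind.auto-crux: conjecture-grade) · rank 0 · open · by planner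
why it might fail: The conjunct on a dense class (shared with CardyGluingRDE): false only if Cardy fails on bond-ℤ² (claimed by unrefereed arXiv:2206.04599, contra arXiv:2409.03235); as the word mechanism's landing point it fails if junction overlaps fail to converge summably (c=0 Jordan cells) or to conformal data.
sources: Cardy1992, Smirnov2001, SchrammSmirnov2011, arXiv:1207.7005, arXiv:1608.00170, arXiv:2206.04599
[target] Cardy's formula in the G02 discretisation for every conformal rectangle whose carrier is
the interior of a finite union of closed δ₀-lattice squares (a polyomino Jordan domain) and whose
four marks are δ₀-lattice points, for some δ₀ > 0 (card: CardyPolygon). -/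
@[route_item "route-CriticalPhenomena-CardyPolygonWords", crux]
def CardyLatticePolygon : Prop :=
  ∀ R : Literature.Probability.RandomPlanarGeometry.ConformalRectangle, (∃ δ₀ : ℝ, 0 < δ₀ ∧ (∃ s : Finset (ℤ × ℤ), R.carrier = interior (⋃ p ∈ s, {z : ℂ | δ₀ * (p.1 : ℝ) ≤ z.re ∧ z.re ≤ δ₀ * ((p.1 : ℝ) + 1) ∧ δ₀ * (p.2 : ℝ) ≤ z.im ∧ z.im ≤ δ₀ * ((p.2 : ℝ) + 1)})) ∧ ∀ i, ∃ m n : ℤ, R.pt i = (δ₀ : ℂ) * ((m : ℂ) + (n : ℂ) * Complex.I)) → R.HasCrossingLimit (Literature.Probability.Percolation.bondDomainCrossingProb R) Literature.Probability.RandomPlanarGeometry.cardyFunction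

/-- item stmt-CriticalPhenomena-4782 · crux · rank 2 · open · by planner
why it might fail: OPEN (Schramm2007ICM Prob. 2.11 cut to rectangles): false iff bond-ℤ² crossing universality fails, as unrefereed arXiv:2206.04599 Cor. 2 claims (contra arXiv:2409.03235, LPSA numerics); the route's engine (uniform-in-level control of TL(β=1) towers AND amplitudes, c=0 logs) is open even in physics.
sources: Cardy1992, Schramm2007ICM, arXiv:2206.04599, arXiv:2409.03235, arXiv:math/9401222, arXiv:1207.7005
[crux] Cardy's formula (G02 discretisation, bond-ℤ², p = 1/2) for every rectangle (0,a)×(0,b) with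
the four CORNERS marked — the words of length one ⟨β|T_n^m|α⟩; the unproved input of the whole
transfer-matrix programme (conclusion of card tl-spectral-kleban-zagier: TL(β=1)/XXZ(Δ=−1/2)
conformal towers + boundary-state overlaps, even conformal block, Kleban–Zagier rigidity + exact ℤ²
duality Π(r)+Π(1/r)=1). Ranked first because everything downstream is conditional on it; this route
adds nothing to its proof and shares the item with any route opened for that card. [difficulty:
open-problem] -/
@[route_item "route-CriticalPhenomena-CardyPolygonWords", crux]
def CardyRectangle : Prop :=
  ∀ (R : Literature.Probability.RandomPlanarGeometry.ConformalRectangle) (a b : ℝ), 0 < a → 0 < b → R.carrier = {z : ℂ | 0 < z.re ∧ z.re < a ∧ 0 < z.im ∧ z.im < b} → Set.range R.pt = {(0 : ℂ), (a : ℂ), (a : ℂ) + (b : ℂ) * Complex.I, (b : ℂ) * Complex.I} → R.HasCrossingLimit (Literature.Probability.Percolation.bondDomainCrossingProb R) Literature.Probability.RandomPlanarGeometry.cardyFunction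

/-- item stmt-CriticalPhenomena-4783 · crux · rank 3 · open · by planner
why it might fail: Contains CardyRectangle (c=0, d=a), so at least as open; as the junction thesis it fails if the lattice width change keeps an O(1) excess length ≠ the Schwarz–Christoffel one, or c=0 log partners enter at the 3π/2 corners (arXiv:1303.3633); kill test (exact TM, widths ≤ 12, vs SC modulus) unrun.
sources: doi:10.1088/1742-5468/2011/03/l03002, arXiv:1902.02246, arXiv:1303.3633, arXiv:1608.00170, arXiv:math/9401222, arXiv:1407.8163
[crux] Cardy's formula (G02 discretisation) for every ONE-STEP polygon — two stacked open rectangles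
(0,a)×(0,b) and (c,d)×(b,b+e) sharing the open stretch (max 0 c, min a d)×{b} of horizontal side —
with the two bottom and the two top corners marked: the words ⟨β|T_{n'}^{m'} J T_n^{m}|α⟩ with
exactly one junction letter (L-, T- and Z-steps, all arm lengths). This is the probability-level
form of the card's cruxes P2+P3: given CardyRectangle, it says that the scaling limits of the
junction overlaps between the boundary-state-visible scaling states exist and equal the
Schwarz–Christoffel step vertex (card corners-are-morphisms, P2 JunctionOverlapLimit / P3
StepMapVertex). [deps: CardyRectangle] [difficulty: XL] -/
@[route_item "route-CriticalPhenomena-CardyPolygonWords", crux]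
def CardyOneStep : Prop :=
  ∀ (R : Literature.Probability.RandomPlanarGeometry.ConformalRectangle) (a b c d e : ℝ), 0 < b → 0 < e → max 0 c < min a d → R.carrier = {z : ℂ | (0 < z.re ∧ z.re < a ∧ 0 < z.im ∧ z.im < b) ∨ (c < z.re ∧ z.re < d ∧ b < z.im ∧ z.im < b + e) ∨ (max 0 c < z.re ∧ z.re < min a d ∧ z.im = b)} → Set.range R.pt = {(0 : ℂ), (a : ℂ), (d : ℂ) + ((b + e : ℝ) : ℂ) * Complex.I, (c : ℂ) + ((b + e : ℝ) : ℂ) * Complex.I} → R.HasCrossingLimit (Literature.Probability.Percolation.bondDomainCrossingProb R) Literature.Probability.RandomPlanarGeometry.cardyFunction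

/-- item stmt-CriticalPhenomena-14409 · crux · rank 4 · open · by planner
why it might fail: Corner-marked one-step words see only reflection-even, boundary-visible sectors of each strip; Z-words (2+ junctions) and general lattice marks need junction limits in ALL TL sectors + two-star wire letters, so the hypotheses under-determine the conclusion; c=0 Jordan cells at junctions.
sources: BondesanJacobsenSaleur2012, Cardy2001, arXiv:1110.6861, doi:10.1088/1742-5468/2011/03/l03002, arXiv:1902.02246, arXiv:1101.2885
[crux] WordSewing — the sewing step of the thesis, filed as the glue Crux… → Target at the
route-choice repair (target-unreachable, 2026-08-16): Cardy's formula for rectangles (words of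
length one, CardyRectangle) and for one-step polygons (one junction letter, CardyOneStep) implies
Cardy's formula for every marked lattice polygon (CardyLatticePolygon). It is a CRUX, not
bookkeeping: the typed hypotheses are probability-level shadows that enter only as normalisation
(rectangle amplitudes and towers) and as the even-sector one-junction datum; they do not
algebraically determine multi-junction words, so the proof must establish the operator-level
content. Intended proof = the route's TWO-LAYER PLAN (a), to be installed by tenure as a glued split
of THIS item once the word vocabulary lands (definition request PercolationPolygonWord): (S1)
RowTransferExactness — at aligned meshes δ = δ₀/N, bondDomainCrossingProb R δ = ⟨β|W|α⟩ exactly, W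
the word of the polyomino in the letters T_S =
Literature.Probability.LatticeModels.PercolationRowTransfer S, junctionInsert/junctionRestrict at
column-set changes, and WIRE letters joining the current row's discrete-arc vertices to ⋆_A / ⋆_B
(two-star -/
@[route_item "route-CriticalPhenomena-CardyPolygonWords", crux]
def WordSewing : Prop :=
  CardyRectangle → CardyOneStep → CardyLatticePolygon

-- item stmt-CriticalPhenomena-5237 · support · rank 4 · open · by planner — informal only, no Lean statement yet:
--   [crux] JunctionOverlapLimit (card corners-are-morphisms P2; operator level — needs the definition
--   request PercolationRowTransfer before a signature can be set). For the stochastic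
--   Temperley–Lieb(β=1) row-transfer matrices T_S of bond-ℤ² percolation (free side walls, bottom-arc
--   marking) and the canonical free-site insertion/restriction maps J_{S,S'} (S ⊆ S' finite column sets:
--   end-steps AND interior gaps, i.e. the pants/merge junctions of non-row-convex polygons): for the
--   low-lying scaling eigenvectors ψ_k^{(S)} of T_S in the sectors visible from the boundary vectors α,
--   β, the normalised overla

-- item stmt-CriticalPhenomena-5275 · support · rank 5 · open · by planner — informal only, no Lean statement yet:
--   [crux] StepMapVertex (card corners-are-morphisms P3; operator level, typed after
--   PercolationRowTransfer lands). The limits of JunctionOverlapLimit ARE the matrix elements of the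
--   boundary-CFT (c = 0) operator Γ implementing the Schwarz–Christoffel map of the local rectilinear
--   geometry — half-strip of width 1 glued to a half-strip of width ρ along a common wall for an
--   end-step, the rectilinear pants for a merge: between primaries ⟨h;ρ|Γ_ρ|h;1⟩ = (κ₋(ρ)κ₊(ρ))^h ×
--   normalisations fixed by the rectangle data (κ± the exponential stretching factors of the step map at
--   the two ends), descendants by the

-- item stmt-CriticalPhenomena-5305 · support · rank 9 · open · by planner — informal only, no Lean statement yet:
--   [support] RowTransferExactness (the lattice dictionary; provable once the definition request
--   PercolationRowTransfer lands). For every conformal rectangle R satisfying the hypothesis of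
--   CardyLatticePolygon with δ₀ = N·δ (aligned mesh, N ≥ 2), bondDomainCrossingProb R δ = ⟨β| W |α⟩
--   EXACTLY, where W is the word read off the row decomposition of the discrete domain Ω_δ (G02:
--   meshDomain = interior lattice points of the polyomino, which induce a connected subgraph at aligned
--   meshes; discreteArc by the closest-arc rule): a factor T_S for each block of rows with constant
--   column set S, a junction lette

-- item stmt-CriticalPhenomena-5332 · support · rank 9 · open · by planner — informal only, no Lean statement yet:
--   [support] GroundStateJunctions (card corners-are-morphisms P5; the free exact sanity layer, typed
--   after PercolationRowTransfer lands). At Δ = −1/2 the h = 0 (stationary / ground-state) junction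
--   overlaps are exact combinatorics: with Ψ_S the Razumov–Stroganov/qKZ stationary vector of the
--   stochastic TL(β=1) chain with open (free) boundaries, the normalised overlap ⟨Ψ_{S'}, J_{S,S'}
--   Ψ_S⟩/(‖Ψ_{S'}‖‖Ψ_S‖) is a ratio of ASM/VSASM-type integers obeying the Di Francesco–Zinn-Justin
--   arch-insertion recursions, with Γ-function product asymptotics as |S| → ∞, |S'|/|S| → ρ. Statement
--   to prove: closed forms

/-- item stmt-CriticalPhenomena-4784 · assembly · rank 1 · closed · proved by Summit.CriticalPhenomena.CardyFormulaZ2.Theorems.CardyPolygonWords_Assembly_proof @ 3116104aeab8 (prover) · by planner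
sources: SchrammSmirnov2011, arXiv:1008.1378, Pommerenke1992, Smirnov2001
[assembly] CardyLatticePolygon → CardyFormulaZ2 (Carathéodory/Radó density of marked lattice
polygons + Schramm–Smirnov RSW equicontinuity of crossing probabilities in the quad + continuity of
cardyFunction). -/
@[route_item "route-CriticalPhenomena-CardyPolygonWords", crux]
def Assembly : Prop :=
  CardyLatticePolygon → CardyFormulaZ2

/-! D-0027 §2.1 — DECIDING THEOREM (planner-authored via `route open/edit --closes-file`; by planner-rchoice-CriticalPhenomena-CardyPolygon-ecc5310d-0 2026-08-16T03:27:53Z):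
its hypotheses are this route's items and its conclusion the sub-problem Statement (glue_lint), and it elaborates with this file. -/

@[closes "route-CriticalPhenomena-CardyPolygonWords"] theorem closes (_h_CardyLatticePolygon : CardyLatticePolygon) (h_CardyRectangle : CardyRectangle)
    (h_CardyOneStep : CardyOneStep) (h_WordSewing : WordSewing) (h_Assembly : Assembly) :
    _root_.CardyFormulaZ2 :=
  -- D-0027 §2.1 deciding theorem of route CardyPolygonWords (route-choice repair 2026-08-16,
  -- target-unreachable ⇒ glue crux WordSewing added). The ranked cruxes CardyRectangle (words of
  -- length one) and CardyOneStep (one junction letter) now reach the target through the sewing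
  -- crux `WordSewing : CardyRectangle → CardyOneStep → CardyLatticePolygon`, and the Assembly item
  -- (polygon reduction: Carathéodory/Radó density of marked lattice polygons + Schramm–Smirnov RSW
  -- quad-equicontinuity + continuity of cardyFunction) carries the target to the sub-problem
  -- Statement. The target item itself stays a hypothesis (route items in route order) but is not
  -- consumed: it is the conclusion of WordSewing. Informal items (JunctionOverlapLimit,
  -- StepMapVertex, RowTransferExactness, GroundStateJunctions) have no decl and cannot be hypotheses.
  h_Assembly (h_WordSewing h_CardyRectangle h_CardyOneStep)

end Summit.CriticalPhenomena.CardyFormulaZ2.Theses.CardyPolygonWords
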